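import Summits.BirchSwinnertonDyer.Rank1Residual.X11b.IntSeriesValueRigidity
import Summits.BirchSwinnertonDyer.Rank1Residual.X11b.FrameLambdaUnit
import Summits.BirchSwinnertonDyer.Rank1Residual.X11b.UnrIntegersValuationRing
import Summits.BirchSwinnertonDyer.Rank1Residual.X11b.BDPFrameUniquenessInt
import HarnessLib

/-!
# X11b — DESCENT of principal-ideal membership along `Λ_{R₀} = R₀⟦T⟧ → 𝓞_{ℂ_p}⟦T⟧`: if `g = u·L`
# with `g, L ∈ R₀⟦T⟧` and `u ∈ 𝓞_{ℂ_p}⟦T⟧` then `u ∈ R₀⟦T⟧` (every prime `p`; theorems only)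
# (cell `b2b-bsdres`, sub-cell `multr1-p2`, gen 26)

HONEST FRAMING (cell `b2b-bsdres`, run/shared/lean/b2b/bsd-rank1-residual/, verbatim in every
file): the goal of the cell is to DELETE the COMBINATION-SHAPED residual classes of the
Birch–Swinnerton-Dyer formula for ALL analytic-rank `≤ 1` elliptic curves over `ℚ` — "full BSD
formula for every rank `≤ 1` curve in class `C`" assembled STRICTLY from published theorems — so
that the rank-`≤ 1` remainder becomes exactly the CONSTRUCTION-SHAPED classes, which are TYPED
(missing-input `Prop`s), NOT attempted. This is not "finishing BSD". Sub-cell `multr1-p2` is a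
RESEARCH ROUTE on class X11b (`ClassX11b W p := r_an = 1 ∧ p ≠ 2 ∧ mult(p) ∧ irr(p)`,
`Partition/Rows.lean`); no claim beyond the stated class and loci; X11b's label does not change;
NOTHING is booked by this file.

THEOREMS ONLY (elementary `p`-adic analysis; no definition, no named fact, no `sorry`); every `p`.

## Why this file

Gens 24–25 of route p2 weakened the open statement to the ♭-currency `𝓞_{ℂ_p}⟦T⟧` ((2.4)∃♭
`P2.IMCDivSomeFrameOnTree`: `Ch_Λ(X_ac)·𝓞_{ℂ_p}⟦T⟧ ⊆ (Q)`), to be independent of the `R₀`-rationality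
of Castella's `L_p(f)` (x11b3-lit1 L59). To compare with the erratum's own display
`Ch_Λ(X_ac)·Λ_{R₀} ⊆ (L_p(f))` one needs that the extension `R₀⟦T⟧ → 𝓞_{ℂ_p}⟦T⟧` REFLECTS membership in
principal ideals. This file proves it by VALUE DESCENT (no Weierstrass preparation, no flatness):

* `intSeries_value_mem_of_coeff_mem` — values of a series with coefficients in a CLOSED subfield
  `S ⊆ ℂ_p` at points of `S` lie in `S`;
* (injectivity of `R₀⟦T⟧ → 𝓞_{ℂ_p}⟦T⟧`: multr1-p1's `R1.map_unrToCpInt_injective`, `X11b/FrameLambdaUnit.lean`, imported);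
* **`unrSeries_mem_span_singleton_of_map_mem`** — `g, L ∈ R₀⟦T⟧`, `g ∈ (L)` in `𝓞_{ℂ_p}⟦T⟧` ⟹ `g ∈ (L)`
  in `R₀⟦T⟧`: with `g = u·L`, `u(p^j) = g(p^j)/L(p^j) ∈ Frac R₀` for `j ≫ 0` (`L(p^j) ≠ 0` by the
  order lemma `intSeries_norm_value_eq_of_order`), `p^j → 0`, so the coefficients of `u` lie in
  `Frac R₀ ∩ 𝓞_{ℂ_p} = R₀` by multr1-p1's `R1.coeff_mem_subring_of_hasValueAt_mem` with
  `R1.isClosed_fracUnr` / `R1.mem_unrIntegers_of_mem_fracUnr`;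
* ideal forms for an ideal `J ⊆ Λ = ℤ_p⟦T⟧`: **`ideal_map_toUnr_le_span_iff`** —
  `J·R₀⟦T⟧ ⊆ (L) ↔ J·𝓞_{ℂ_p}⟦T⟧ ⊆ (L)`.

Consumer: `X11b/BDPRouteOpenInputDescent.lean` ((2.4)∃♭ ⟹ erratum (2.4) for every `R₀`-frame).

References: [Castella2018] §2.2, §3 (arXiv:1704.06608 pp. 5, 9); [Cassels1986] Ch. 4 §1 Lemma 1.3 (convergence in complete fields; locator corrected 2026-08-21 per x11b3-lit1 L84 F2 — the earlier "Ch. 4 Lemma 2.1" was wrong).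
-/

noncomputable section

open scoped Classical Topology

open Filter PowerSeries
open Literature.NumberTheory.EllipticCurves
open Literature.NumberTheory.LFunctions.Dwork (norm_natCast_p_padicComplex)
open Summit.BirchSwinnertonDyer.Rank1Residual.X11b.Halves

namespace Summit.BirchSwinnertonDyer.Rank1Residual.X11b

/-! ### §1 Descent of principal-ideal membership along `R₀⟦T⟧ → 𝓞_{ℂ_p}⟦T⟧` (every `p`) -/

section Descent

variable {p : ℕ} [hp : Fact p.Prime]

/-- **Values in a closed subfield**: if every coefficient of `Q ∈ 𝓞_{ℂ_p}⟦T⟧` lies in a CLOSED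
subfield `S ⊆ ℂ_p` and `x ∈ S`, then the value `Q(x)` lies in `S` (partial sums lie in `S`;
convergence of series in a complete non-archimedean field). [folklore]
[cite: Cassels1986, Ch. 4 §1, Lemma 1.3 and display (1.11)] -/
theorem intSeries_value_mem_of_coeff_mem (S : Subfield ℂ_[p]) (hS : IsClosed (S : Set ℂ_[p]))
    {Q : PowerSeries 𝓞_ℂ_[p]} (hQ : ∀ n, ((PowerSeries.coeff n Q : 𝓞_ℂ_[p]) : ℂ_[p]) ∈ S)
    {x v : ℂ_[p]} (hx : x ∈ S) (h : IntSeries.HasValueAt Q x v) : v ∈ S :=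
  hS.mem_of_tendsto h.tendsto_sum_nat
    (Eventually.of_forall fun _ ↦ sum_mem fun k _ ↦ S.mul_mem (hQ k) (S.pow_mem hx k))

/-- **DESCENT: `R₀⟦T⟧ → 𝓞_{ℂ_p}⟦T⟧` reflects membership in principal ideals.** If `g, L ∈ R₀⟦T⟧` and
`g ∈ (L)` in `𝓞_{ℂ_p}⟦T⟧` (i.e. `g = u·L`, `u ∈ 𝓞_{ℂ_p}⟦T⟧`), then `g ∈ (L)` in `R₀⟦T⟧`. Proof (value
descent, no Weierstrass preparation): `L = 0` is trivial; else let `c ≠ 0` be the coefficient of `L`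
at its order `d` and take the points `x_j = p^{j+m+1}` with `p^{−m} < ‖c‖`; then `‖L(x_j)‖ =
‖x_j‖^d‖c‖ ≠ 0` (order lemma), `u(x_j) = g(x_j)/L(x_j)` lies in the CLOSED subfield `Frac R₀`
(values of `R₀`-series at `R₀`-points), `x_j → 0`, so every coefficient of `u` lies in
`Frac R₀ ∩ 𝓞_{ℂ_p} = R₀` (multr1-p1's `R1.coeff_mem_subring_of_hasValueAt_mem`,
`R1.isClosed_fracUnr`, `R1.mem_unrIntegers_of_mem_fracUnr`), i.e. `u ∈ R₀⟦T⟧`.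
[cite: Castella2018, §2.2 and §3 (arXiv:1704.06608 pp. 5, 9)] [cite: Cassels1986, Ch. 4 §1, Lemma 1.3] -/
theorem unrSeries_mem_span_singleton_of_map_mem {g L : UnrSeries p}
    (h : PowerSeries.map (R1.unrToCpInt p) g ∈
      Ideal.span ({PowerSeries.map (R1.unrToCpInt p) L} : Set (PowerSeries 𝓞_ℂ_[p]))) :
    g ∈ Ideal.span ({L} : Set (UnrSeries p)) := by
  have hp' : p.Prime := hp.out
  obtain ⟨u, hu⟩ := Ideal.mem_span_singleton'.mp h
  set Lc := PowerSeries.map (R1.unrToCpInt p) L with hLc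
  set gc := PowerSeries.map (R1.unrToCpInt p) g with hgc
  rcases eq_or_ne L 0 with rfl | hL0
  · have hg : g = 0 := R1.map_unrToCpInt_injective (p := p) (by
      rw [← hgc, ← hu, hLc, map_zero, mul_zero])
    rw [hg]
    exact Ideal.zero_mem _
  have hLc0 : Lc ≠ 0 := fun h0 ↦ hL0 (R1.map_unrToCpInt_injective (p := p) (by
    rw [← hLc, h0, map_zero]))
  -- the first non-zero coefficient `c` of `Lc`
  set d := Lc.order.toNat with hd
  set c : ℂ_[p] := ((PowerSeries.coeff d Lc : 𝓞_ℂ_[p]) : ℂ_[p]) with hcdef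
  have hc0 : c ≠ 0 := by
    intro h0
    apply PowerSeries.coeff_order hLc0
    rw [← hd]
    exact Subtype.ext (by simpa [hcdef] using h0)
  -- `m` with `p^{-m} < ‖c‖`
  have hpinv0 : 0 ≤ (p : ℝ)⁻¹ := inv_nonneg.mpr (by positivity)
  have hpinv1 : (p : ℝ)⁻¹ < 1 := inv_lt_one_of_one_lt₀ (by exact_mod_cast hp'.one_lt)
  obtain ⟨m, hm⟩ : ∃ m : ℕ, ((p : ℝ)⁻¹) ^ m < ‖c‖ :=
    ((tendsto_pow_atTop_nhds_zero_of_lt_one hpinv0 hpinv1).eventually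
      (gt_mem_nhds (norm_pos_iff.mpr hc0))).exists
  -- the points `x_j = p^{j+m+1}`
  set x : ℕ → ℂ_[p] := fun j ↦ (p : ℂ_[p]) ^ (j + m + 1) with hxdef
  have hxnorm : ∀ j, ‖x j‖ = ((p : ℝ)⁻¹) ^ (j + m + 1) := fun j ↦ by
    simp only [hxdef, norm_pow, norm_natCast_p_padicComplex]
  have hx1 : ∀ j, ‖x j‖ < 1 := fun j ↦ by
    rw [hxnorm]; exact pow_lt_one₀ hpinv0 hpinv1 (by omega)
  have hxc : ∀ j, ‖x j‖ < ‖c‖ := fun j ↦ by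
    rw [hxnorm]
    exact (pow_le_pow_of_le_one hpinv0 hpinv1.le (by omega)).trans_lt hm
  have hx0 : ∀ j, x j ≠ 0 := fun j ↦
    pow_ne_zero _ (by exact_mod_cast hp'.ne_zero)
  have hxlim : Tendsto x atTop (𝓝 0) := by
    refine tendsto_zero_iff_norm_tendsto_zero.mpr ?_
    have h := (tendsto_pow_atTop_nhds_zero_of_lt_one hpinv0 hpinv1).comp
      (tendsto_add_atTop_nat (m + 1))
    refine h.congr fun j ↦ ?_
    simp only [Function.comp_apply, hxnorm, add_assoc]
  -- the closed subfield `S = Frac R₀`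
  set S : Subfield ℂ_[p] := Subfield.closure (unrIntegers p : Set ℂ_[p]) with hSdef
  have hS : IsClosed (S : Set ℂ_[p]) := R1.isClosed_fracUnr
  have hR₀S : ∀ z : ℂ_[p], z ∈ unrIntegers p → z ∈ S := fun z hz ↦ Subfield.subset_closure hz
  have hxS : ∀ j, x j ∈ S := fun j ↦ S.pow_mem (hR₀S _ (natCast_mem (unrIntegers p) p)) _
  -- values of `Lc`, `gc`, `u` at the points
  choose ℓ hℓ using fun j ↦ intSeries_exists_hasValueAt Lc (hx1 j)
  choose w hw using fun j ↦ intSeries_exists_hasValueAt u (hx1 j)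
  have hℓ0 : ∀ j, ℓ j ≠ 0 := fun j h0 ↦ by
    have hval := intSeries_norm_value_eq_of_order (hx1 j) (hxc j) (hℓ j)
    rw [h0, norm_zero] at hval
    exact (mul_pos (pow_pos (norm_pos_iff.mpr (hx0 j)) _) (norm_pos_iff.mpr hc0)).ne hval
  -- coefficients of `Lc`, `gc` lie in `R₀ ⊆ S`, hence so do their values at `x_j`
  have hcoefL : ∀ n, ((PowerSeries.coeff n Lc : 𝓞_ℂ_[p]) : ℂ_[p]) ∈ S := fun n ↦ by
    rw [hLc, PowerSeries.coeff_map, R1.coe_unrToCpInt]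
    exact hR₀S _ (PowerSeries.coeff n L).2
  have hcoefg : ∀ n, ((PowerSeries.coeff n gc : 𝓞_ℂ_[p]) : ℂ_[p]) ∈ S := fun n ↦ by
    rw [hgc, PowerSeries.coeff_map, R1.coe_unrToCpInt]
    exact hR₀S _ (PowerSeries.coeff n g).2
  have hℓS : ∀ j, ℓ j ∈ S := fun j ↦
    intSeries_value_mem_of_coeff_mem S hS hcoefL (hxS j) (hℓ j)
  -- `u(x_j) = g(x_j) / L(x_j) ∈ S`
  have hwS : ∀ j, w j ∈ S := fun j ↦ by
    have hprod : IntSeries.HasValueAt gc (x j) (w j * ℓ j) := by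
      rw [← hu]
      exact intSeries_hasValueAt_mul (hx1 j) (hw j) (hℓ j)
    have hgS : w j * ℓ j ∈ S := intSeries_value_mem_of_coeff_mem S hS hcoefg (hxS j) hprod
    have : w j = w j * ℓ j / ℓ j := by rw [mul_div_cancel_right₀ _ (hℓ0 j)]
    rw [this]
    exact div_mem hgS (hℓS j)
  -- descent of the coefficients of `u`
  have hucoef : ∀ n, ((PowerSeries.coeff n u : 𝓞_ℂ_[p]) : ℂ_[p]) ∈ unrIntegers p := fun n ↦
    R1.coeff_mem_subring_of_hasValueAt_mem S hS (unrIntegers p)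
      (fun z hz hz1 ↦ R1.mem_unrIntegers_of_mem_fracUnr hz hz1) hxlim hx0 hxS hwS hw n
  let u₀ : UnrSeries p := PowerSeries.mk fun n ↦ ⟨((PowerSeries.coeff n u : 𝓞_ℂ_[p]) : ℂ_[p]), hucoef n⟩
  have hu₀ : PowerSeries.map (R1.unrToCpInt p) u₀ = u := by
    ext n
    simp [u₀, PowerSeries.coeff_map, PowerSeries.coeff_mk]
  refine Ideal.mem_span_singleton'.mpr ⟨u₀, R1.map_unrToCpInt_injective (p := p) ?_⟩
  rw [map_mul, hu₀, ← hLc, hu]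

/-- **Ideal form of the descent**: for an ideal `J` of `Λ = ℤ_p⟦T⟧` and `L ∈ R₀⟦T⟧`,
`J·𝓞_{ℂ_p}⟦T⟧ ⊆ (L)` in `𝓞_{ℂ_p}⟦T⟧` implies `J·R₀⟦T⟧ ⊆ (L)` in `R₀⟦T⟧`.
[cite: Castella2018, §3 (arXiv:1704.06608 p. 9)] -/
theorem ideal_map_toUnr_le_span_of_map_toCpInt_le (J : Ideal (IwasawaAlgebra p)) (L : UnrSeries p)
    (h : J.map (PowerSeries.map (R1.toCpInt p)) ≤
      Ideal.span {PowerSeries.map (R1.unrToCpInt p) L}) :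
    J.map (PowerSeries.map (toUnr p)) ≤ Ideal.span {L} := by
  rw [Ideal.map_le_iff_le_comap]
  intro g hg
  rw [Ideal.mem_comap]
  refine unrSeries_mem_span_singleton_of_map_mem (h ?_)
  rw [R1.map_toCpInt_eq_comp, ← Ideal.map_map]
  exact Ideal.mem_map_of_mem _ (Ideal.mem_map_of_mem _ hg)

/-- The converse (trivial direction): `J·R₀⟦T⟧ ⊆ (L)` in `R₀⟦T⟧` implies `J·𝓞_{ℂ_p}⟦T⟧ ⊆ (L)` in
`𝓞_{ℂ_p}⟦T⟧`. [cite: Castella2018, §3 (arXiv:1704.06608 p. 9)] -/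
theorem ideal_map_toCpInt_le_span_of_map_toUnr_le (J : Ideal (IwasawaAlgebra p)) (L : UnrSeries p)
    (h : J.map (PowerSeries.map (toUnr p)) ≤ Ideal.span {L}) :
    J.map (PowerSeries.map (R1.toCpInt p)) ≤
      Ideal.span {PowerSeries.map (R1.unrToCpInt p) L} := by
  rw [R1.map_toCpInt_eq_comp, ← Ideal.map_map]
  refine (Ideal.map_mono h).trans ?_
  rw [Ideal.map_span, Set.image_singleton]

/-- **So membership does not see the receptacle**: `J·R₀⟦T⟧ ⊆ (L)` iff `J·𝓞_{ℂ_p}⟦T⟧ ⊆ (L)`.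
[cite: Castella2018, §3 (arXiv:1704.06608 p. 9)] -/
theorem ideal_map_toUnr_le_span_iff (J : Ideal (IwasawaAlgebra p)) (L : UnrSeries p) :
    J.map (PowerSeries.map (toUnr p)) ≤ Ideal.span {L} ↔
      J.map (PowerSeries.map (R1.toCpInt p)) ≤
        Ideal.span {PowerSeries.map (R1.unrToCpInt p) L} :=
  ⟨ideal_map_toCpInt_le_span_of_map_toUnr_le J L, ideal_map_toUnr_le_span_of_map_toCpInt_le J L⟩

end Descent

end Summit.BirchSwinnertonDyer.Rank1Residual.X11b

end
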